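import Mathlib
import Literature.NumberTheory.Transcendental.KernelTranslatesRankTwoSectors

/-!
# Mates of a rank-2 first failure, II: growth of the zeros of exponential polynomials — crux stmt-Schanuel-0969

Route `RigidCore`, crux (S*) `MinimalCounterexampleInAcl` (item stmt-Schanuel-0969), line `kernel-arithmetic-selection`
(lead prover-line-stmt-Schanuel-0969-c6-0), landed `--supports stmt-Schanuel-0969`.  This makes IMPORTABLE the analytic toolkit of
the crux disprover's work file `Cruxes/MinimalCounterexampleInAcl/DisproofRankTwo.lean` (refuter-cdisprove-stmt-Schanuel-0969-g4,
§18–§19; adapted verbatim up to spelling out its two helper definitions as local notation), on which the gen-19 skeleton's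
SECOND-LEVEL SELECTION stubs rest (growth of the coefficients of a second-level relation along the mates).

`cauchy_bound` (Cauchy's root bound), `norm_eval_le` / `exists_norm_eval_ge` (complex polynomials), the normal form
`m(e^s, s) = Σ_{j≤d} g_j(s) e^{js}` (`expPoly_eq_sum`), and **for the large zeros `s` of a non-zero `m(e^s, s)`,
`m ∈ ℚ[T, S]`: `‖e^s‖ ≤ max 1 (C (1+‖s‖)^D)` (`norm_exp_le_of_expPoly_eq_zero`, leading-coefficient dominance) and
`‖e^{-s}‖ ≤ max 1 (C (1+‖s‖)^D)` (`norm_exp_neg_le_of_expPoly_eq_zero`, trailing-coefficient dominance; Pólya)**.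

Notation (local, no definitions): `expPoly[m, s] = MvPolynomial.aeval ![cexp s, s] m`,
`coefC[c] = (uniqueAlgEquiv ℚ (Fin 1) c).map (algebraMap ℚ ℂ)`.

## References

* [Lindemann1882] F. Lindemann, *Über die Zahl π*, Math. Ann. 20 (1882) (tree `transcendental_exp_holds`).
* [Polya1920] G. Pólya, *Geometrisches über die Verteilung der Nullstellen gewisser ganzer transzendenter
  Funktionen*, Münch. Sitzungsber. 50 (1920) (zeros of exponential polynomials lie in logarithmic strips).
-/

noncomputable section

set_option linter.dupNamespace false

open Complex Polynomial Set Filter Topology Bornology Finset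
open Literature.NumberTheory.Transcendental
open Literature.NumberTheory.Transcendental.KernelTranslatesRankTwo (eval_map_finSuccEquiv
  finite_setOf_aeval_eq_zero exists_mvPolynomial_of_trdeg_lt_two)

-- adapted from Cruxes/MinimalCounterexampleInAcl/DisproofRankTwo.lean (refuter-cdisprove-stmt-Schanuel-0969-g4, rc 0)
namespace Summit.Schanuel.Schanuel.Cruxes.MinimalCounterexampleInAcl.KernelArithmeticSelection.MateGrowth

/-- The one-variable exponential polynomial `s ↦ m(e^s, s)` attached to `m ∈ ℚ[T, S]` (local notation, no
definition: `expPoly[m, s]` is literally `MvPolynomial.aeval ![cexp s, s] m`). -/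
local notation3 "expPoly[" m ", " s "]" => (MvPolynomial.aeval ![Complex.exp s, s] m : ℂ)

/-- A coefficient `c ∈ ℚ[S]` (as `MvPolynomial (Fin 1) ℚ`) viewed as a complex polynomial (local notation, no
definition). -/
local notation3 "coefC[" c "]" =>
  (Polynomial.map (algebraMap ℚ ℂ) (MvPolynomial.uniqueAlgEquiv ℚ (Fin 1) c) : Polynomial ℂ)

/-! ## §19 Growth of the zeros of exponential polynomials: the escape is VERTICAL -/


/-! ### Cauchy's root bound -/

/-- **Cauchy bound**: if `Σ_{j ≤ d} a j * w^j = 0` with `a d ≠ 0` then `‖w‖ ≤ max 1 ((Σ_{j<d} ‖a j‖)/‖a d‖)`. -/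
theorem cauchy_bound {d : ℕ} (a : ℕ → ℂ) (w : ℂ) (hd : a d ≠ 0)
    (hz : ∑ j ∈ range (d + 1), a j * w ^ j = 0) :
    ‖w‖ ≤ max 1 ((∑ j ∈ range d, ‖a j‖) / ‖a d‖) := by
  by_cases hw : ‖w‖ ≤ 1
  · exact hw.trans (le_max_left _ _)
  · push Not at hw
    refine le_trans ?_ (le_max_right _ _)
    have hwpos : 0 < ‖w‖ := lt_trans zero_lt_one hw
    have had : 0 < ‖a d‖ := norm_pos_iff.2 hd
    -- `a d * w^d = - Σ_{j<d} a j w^j`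
    rw [Finset.sum_range_succ] at hz
    have heq : a d * w ^ d = -(∑ j ∈ range d, a j * w ^ j) := eq_neg_of_add_eq_zero_right hz
    have hle : ‖a d‖ * ‖w‖ ^ d ≤ (∑ j ∈ range d, ‖a j‖) * ‖w‖ ^ (d - 1) := by
      have h1 : ‖a d * w ^ d‖ = ‖a d‖ * ‖w‖ ^ d := by rw [norm_mul, norm_pow]
      rw [← h1, heq, norm_neg]
      refine (norm_sum_le _ _).trans ?_
      rw [Finset.sum_mul]
      refine Finset.sum_le_sum fun j hj => ?_
      rw [norm_mul, norm_pow]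
      have hj' : j ≤ d - 1 := by have := Finset.mem_range.1 hj; omega
      exact mul_le_mul_of_nonneg_left (pow_le_pow_right₀ hw.le hj') (norm_nonneg _)
    -- divide by `‖w‖^{d-1} > 0`
    rcases Nat.eq_zero_or_pos d with rfl | hdpos
    · exfalso
      simp at heq
      exact hd heq
    · have hpos : 0 < ‖w‖ ^ (d - 1) := pow_pos hwpos _
      have key : (‖a d‖ * ‖w‖) * ‖w‖ ^ (d - 1) ≤ (∑ j ∈ range d, ‖a j‖) * ‖w‖ ^ (d - 1) := by
        calc (‖a d‖ * ‖w‖) * ‖w‖ ^ (d - 1) = ‖a d‖ * ‖w‖ ^ d := by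
              rw [mul_assoc, ← pow_succ', Nat.sub_add_cancel hdpos]
          _ ≤ _ := hle
      have hle' : ‖a d‖ * ‖w‖ ≤ ∑ j ∈ range d, ‖a j‖ := le_of_mul_le_mul_right key hpos
      rw [le_div_iff₀ had]
      linarith [hle']

/-! ### Growth of complex polynomials -/

/-- Polynomial upper bound `‖p(s)‖ ≤ (Σ ‖coeff‖) (1 + ‖s‖)^{deg p}`. -/
theorem norm_eval_le (p : ℂ[X]) (s : ℂ) :
    ‖p.eval s‖ ≤ (∑ i ∈ range (p.natDegree + 1), ‖p.coeff i‖) * (1 + ‖s‖) ^ p.natDegree := by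
  rw [Polynomial.eval_eq_sum_range, Finset.sum_mul]
  refine (norm_sum_le _ _).trans (Finset.sum_le_sum fun i hi => ?_)
  rw [norm_mul, norm_pow]
  refine mul_le_mul_of_nonneg_left ?_ (norm_nonneg _)
  have hi' : i ≤ p.natDegree := by have := Finset.mem_range.1 hi; omega
  have h1 : ‖s‖ ^ i ≤ (1 + ‖s‖) ^ i :=
    pow_le_pow_left₀ (norm_nonneg _) (by linarith [norm_nonneg s]) i
  have h2 : (1 + ‖s‖) ^ i ≤ (1 + ‖s‖) ^ p.natDegree :=
    pow_le_pow_right₀ (by linarith [norm_nonneg s]) hi'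
  exact h1.trans h2

/-- Polynomial lower bound far out: a non-zero complex polynomial is bounded below by a positive
constant outside a large disc. -/
theorem exists_norm_eval_ge (p : ℂ[X]) (hp : p ≠ 0) :
    ∃ R₀ κ : ℝ, 0 < κ ∧ ∀ s : ℂ, R₀ ≤ ‖s‖ → κ ≤ ‖p.eval s‖ := by
  by_cases hdeg : 0 < p.degree
  · have ht : Tendsto (fun s : ℂ => ‖p.eval s‖) (cobounded ℂ) atTop :=
      p.tendsto_norm_atTop hdeg tendsto_norm_cobounded_atTop
    have hev : ∀ᶠ s in cobounded ℂ, 1 ≤ ‖p.eval s‖ := ht.eventually (eventually_ge_atTop 1)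
    obtain ⟨r, -, hr⟩ := (Metric.hasBasis_cobounded_compl_closedBall (0 : ℂ)).eventually_iff.1 hev
    refine ⟨r + 1, 1, one_pos, fun s hs => hr ?_⟩
    simp only [Set.mem_compl_iff, Metric.mem_closedBall, dist_zero_right, not_le]
    linarith
  · -- constant polynomial
    have hdeg' : p.degree ≤ 0 := not_lt.1 hdeg
    rw [Polynomial.eq_C_of_degree_le_zero hdeg'] at hp ⊢
    have hc : p.coeff 0 ≠ 0 := fun h => hp (by rw [h, map_zero])
    refine ⟨0, ‖p.coeff 0‖, norm_pos_iff.2 hc, fun s _ => ?_⟩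
    rw [Polynomial.eval_C]

/-! ### Exponential polynomials `m(e^s, s)` in normal form -/


/-- Evaluation of a coefficient `c ∈ ℚ[S]` at `s` is evaluation of the complex polynomial `coefC[c]`. -/
theorem aeval_eq_eval_coefC (c : MvPolynomial (Fin 1) ℚ) (s : ℂ) :
    MvPolynomial.aeval (fun _ : Fin 1 => s) c = coefC[c].eval s := by
  rw [Polynomial.eval_map, MvPolynomial.aeval_def]
  exact (MvPolynomial.eval₂_uniqueAlgEquiv (R := ℚ) (σ := Fin 1) (f := c) (φ := algebraMap ℚ ℂ)
    (a := fun _ => s)).symm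

/-- A non-zero coefficient gives a non-zero complex polynomial. -/
theorem coefC_ne_zero {c : MvPolynomial (Fin 1) ℚ} (hc : c ≠ 0) : coefC[c] ≠ 0 := by
  rw [Ne, Polynomial.map_eq_zero_iff (algebraMap ℚ ℂ).injective]
  exact (EmbeddingLike.map_ne_zero_iff).2 hc

/-- **Normal form**: `m(e^s, s) = Σ_{j ≤ d} g_j(s) e^{js}` with `g_j = coefC[M.coeff j]`,
`M = finSuccEquiv m` (outer variable `T = e^s`), `d = deg_T m`. -/
theorem expPoly_eq_sum (m : MvPolynomial (Fin 2) ℚ) (s : ℂ) :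
    expPoly[m, s] = ∑ j ∈ range ((MvPolynomial.finSuccEquiv ℚ 1 m).natDegree + 1),
      (coefC[(MvPolynomial.finSuccEquiv ℚ 1 m).coeff j]).eval s * cexp s ^ j := by
  set M := MvPolynomial.finSuccEquiv ℚ 1 m with hM
  have h := eval_map_finSuccEquiv m (cexp s) s
  rw [← h, ← hM]
  rw [Polynomial.eval_eq_sum_range' (n := M.natDegree + 1)]
  · refine Finset.sum_congr rfl fun j _ => ?_
    rw [Polynomial.coeff_map]
    congr 1
    exact aeval_eq_eval_coefC (M.coeff j) s
  · exact Nat.lt_succ_of_le (Polynomial.natDegree_map_le)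

/-- **THE EXPONENTIAL OF A LARGE ZERO IS AT MOST POLYNOMIAL IN THE ZERO** (leading-coefficient
dominance; Pólya): for a non-zero `m ∈ ℚ[T, S]` there are `R₀, C, D` with
`‖e^s‖ ≤ max 1 (C (1 + ‖s‖)^D)` for every zero `s` of `m(e^s, s)` with `‖s‖ ≥ R₀`; equivalently
`Re s ≤ log⁺(C (1+‖s‖)^D) = O(log ‖s‖)`: zeros escape to infinity only with `|Im s| → ∞`, nearly
vertically. -/
theorem norm_exp_le_of_expPoly_eq_zero {m : MvPolynomial (Fin 2) ℚ} (hm : m ≠ 0) :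
    ∃ R₀ C : ℝ, ∃ D : ℕ, 0 ≤ C ∧ ∀ s : ℂ, expPoly[m, s] = 0 → R₀ ≤ ‖s‖ →
      ‖cexp s‖ ≤ max 1 (C * (1 + ‖s‖) ^ D) := by
  classical
  set M := MvPolynomial.finSuccEquiv ℚ 1 m with hM
  have hM0 : M ≠ 0 := by rw [hM]; exact (EmbeddingLike.map_ne_zero_iff).2 hm
  set d := M.natDegree with hd
  set g : ℕ → ℂ[X] := fun j => coefC[M.coeff j] with hg
  have hgd : g d ≠ 0 := coefC_ne_zero (by rw [hd]; exact Polynomial.leadingCoeff_ne_zero.2 hM0)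
  obtain ⟨R₀, κ, hκ, hlow⟩ := exists_norm_eval_ge (g d) hgd
  -- polynomial growth of the lower coefficients
  set Cj : ℕ → ℝ := fun j => ∑ i ∈ range ((g j).natDegree + 1), ‖(g j).coeff i‖ with hCj
  have hCj0 : ∀ j, 0 ≤ Cj j := fun j => Finset.sum_nonneg fun i _ => norm_nonneg _
  set D : ℕ := (range d).sup fun j => (g j).natDegree with hD
  set K : ℝ := ∑ j ∈ range d, Cj j with hK
  have hK0 : 0 ≤ K := Finset.sum_nonneg fun j _ => hCj0 j
  refine ⟨R₀, K / κ, D, div_nonneg hK0 hκ.le, fun s hs hR => ?_⟩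
  have hP1 : 1 ≤ 1 + ‖s‖ := by linarith [norm_nonneg s]
  -- the zero, in normal form
  have hz : ∑ j ∈ range (d + 1), (g j).eval s * cexp s ^ j = 0 := by
    rw [← hs, expPoly_eq_sum]
  have hcb := cauchy_bound (fun j => (g j).eval s) (cexp s) (d := d)
    (fun h0 => (lt_of_lt_of_le hκ (hlow s hR)).ne' (by rw [h0, norm_zero])) hz
  refine hcb.trans (max_le_max le_rfl ?_)
  -- `Σ_{j<d} ‖g_j(s)‖ / ‖g_d(s)‖ ≤ (K/κ)(1+‖s‖)^D`
  have hnum : ∑ j ∈ range d, ‖(g j).eval s‖ ≤ K * (1 + ‖s‖) ^ D := by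
    rw [hK, Finset.sum_mul]
    refine Finset.sum_le_sum fun j hj => ?_
    refine (norm_eval_le (g j) s).trans ?_
    refine mul_le_mul_of_nonneg_left ?_ (hCj0 j)
    exact pow_le_pow_right₀ hP1 (Finset.le_sup (f := fun j => (g j).natDegree) hj)
  have hden : κ ≤ ‖(g d).eval s‖ := hlow s hR
  have hden0 : 0 < ‖(g d).eval s‖ := lt_of_lt_of_le hκ hden
  calc (∑ j ∈ range d, ‖(g j).eval s‖) / ‖(g d).eval s‖
      ≤ (K * (1 + ‖s‖) ^ D) / κ := by
        exact div_le_div₀ (mul_nonneg hK0 (pow_nonneg (by linarith) _)) hnum hκ hden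
    _ = K / κ * (1 + ‖s‖) ^ D := by ring

/-- Coefficients below the trailing degree vanish, so their `coefC` vanish. -/
theorem coefC_coeff_eq_zero_of_lt {M : Polynomial (MvPolynomial (Fin 1) ℚ)} {j : ℕ}
    (hj : j < M.natTrailingDegree) : coefC[M.coeff j] = 0 := by
  rw [Polynomial.coeff_eq_zero_of_lt_natTrailingDegree hj, map_zero, Polynomial.map_zero]

/-- **Mirror bound: the exponential of a large zero is at least INVERSE-polynomial** —
`‖e^{-s}‖ ≤ max 1 (C (1+‖s‖)^D)`, i.e. `Re s ≥ −log⁺(C(1+‖s‖)^D)` (trailing-coefficient dominance).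
Together with `norm_exp_le_of_expPoly_eq_zero`: `|Re s| = O(log ‖s‖)` on the zero set. -/
theorem norm_exp_neg_le_of_expPoly_eq_zero {m : MvPolynomial (Fin 2) ℚ} (hm : m ≠ 0) :
    ∃ R₀ C : ℝ, ∃ D : ℕ, 0 ≤ C ∧ ∀ s : ℂ, expPoly[m, s] = 0 → R₀ ≤ ‖s‖ →
      ‖cexp (-s)‖ ≤ max 1 (C * (1 + ‖s‖) ^ D) := by
  classical
  set M := MvPolynomial.finSuccEquiv ℚ 1 m with hM
  have hM0 : M ≠ 0 := by rw [hM]; exact (EmbeddingLike.map_ne_zero_iff).2 hm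
  set d := M.natDegree with hd
  set t := M.natTrailingDegree with ht
  have htd : t ≤ d := Polynomial.natTrailingDegree_le_natDegree M
  set g : ℕ → ℂ[X] := fun j => coefC[M.coeff j] with hg
  have hgt : g t ≠ 0 := coefC_ne_zero (by
    rw [ht]; exact mt Polynomial.trailingCoeff_eq_zero.1 hM0)
  obtain ⟨R₀, κ, hκ, hlow⟩ := exists_norm_eval_ge (g t) hgt
  set Cj : ℕ → ℝ := fun j => ∑ i ∈ range ((g j).natDegree + 1), ‖(g j).coeff i‖ with hCj
  have hCj0 : ∀ j, 0 ≤ Cj j := fun j => Finset.sum_nonneg fun i _ => norm_nonneg _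
  set D : ℕ := (range (d + 1)).sup fun j => (g j).natDegree with hD
  set K : ℝ := ∑ j ∈ range (d + 1), Cj j with hK
  have hK0 : 0 ≤ K := Finset.sum_nonneg fun j _ => hCj0 j
  refine ⟨R₀, K / κ, D, div_nonneg hK0 hκ.le, fun s hs hR => ?_⟩
  have hP1 : 1 ≤ 1 + ‖s‖ := by linarith [norm_nonneg s]
  have hz : ∑ j ∈ range (d + 1), (g j).eval s * cexp s ^ j = 0 := by
    rw [← hs, expPoly_eq_sum]
  -- reflected coefficients `a k = g_{d-k}(s)`, variable `w' = e^{-s}`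
  set a : ℕ → ℂ := fun k => (g (d - k)).eval s with ha
  set d' := d - t with hd'
  have hrefl : ∑ k ∈ range (d + 1), a k * cexp (-s) ^ k = 0 := by
    have h1 : ∑ k ∈ range (d + 1), a k * cexp (-s) ^ k =
        ∑ j ∈ range (d + 1), (g j).eval s * cexp (-s) ^ (d - j) := by
      rw [← Finset.sum_range_reflect (fun j => (g j).eval s * cexp (-s) ^ (d - j)) (d + 1)]
      refine Finset.sum_congr rfl fun k hk => ?_
      have hk' : k ≤ d := Nat.lt_succ_iff.1 (Finset.mem_range.1 hk)
      simp only [ha, Nat.add_sub_cancel]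
      rw [Nat.sub_sub_self hk']
    rw [h1]
    have h2 : ∑ j ∈ range (d + 1), (g j).eval s * cexp (-s) ^ (d - j) =
        cexp (-s) ^ d * ∑ j ∈ range (d + 1), (g j).eval s * cexp s ^ j := by
      rw [Finset.mul_sum]
      refine Finset.sum_congr rfl fun j hj => ?_
      have hj' : j ≤ d := Nat.lt_succ_iff.1 (Finset.mem_range.1 hj)
      have hpow : cexp (-s) ^ (d - j) = cexp (-s) ^ d * cexp s ^ j := by
        have : cexp (-s) ^ d = cexp (-s) ^ (d - j) * cexp (-s) ^ j := by
          rw [← pow_add, Nat.sub_add_cancel hj']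
        rw [this, mul_assoc, ← mul_pow, ← Complex.exp_add, neg_add_cancel, Complex.exp_zero,
          one_pow, mul_one]
      rw [hpow]; ring
    rw [h2, hz, mul_zero]
  -- terms with `k > d'` vanish (coefficients below the trailing degree)
  have hvan : ∀ k, d' < k → k ≤ d → a k = 0 := by
    intro k hk hkd
    simp only [ha]
    have : d - k < t := by rw [hd'] at hk; omega
    rw [hg]
    simp only
    rw [coefC_coeff_eq_zero_of_lt (by rw [← ht]; exact this), Polynomial.eval_zero]
  have hz' : ∑ k ∈ range (d' + 1), a k * cexp (-s) ^ k = 0 := by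
    rw [← hrefl]
    have hsub : range (d' + 1) ⊆ range (d + 1) :=
      Finset.range_subset_range.2 (Nat.succ_le_succ (by rw [hd']; exact Nat.sub_le d t))
    refine Finset.sum_subset hsub fun k hk hk' => ?_
    have h1 := Finset.mem_range.1 hk
    have h2 : ¬ k < d' + 1 := fun h => hk' (Finset.mem_range.2 h)
    rw [hvan k (by omega) (by omega), zero_mul]
  have had' : a d' = (g t).eval s := by
    simp only [ha, hd']
    rw [Nat.sub_sub_self htd]
  have hcb := cauchy_bound a (cexp (-s)) (d := d')
    (fun h0 => (lt_of_lt_of_le hκ (hlow s hR)).ne' (by rw [← had', h0, norm_zero])) hz'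
  refine hcb.trans (max_le_max le_rfl ?_)
  have hnum : ∑ k ∈ range d', ‖a k‖ ≤ K * (1 + ‖s‖) ^ D := by
    have hterm : ∀ k ∈ range d', ‖a k‖ ≤ Cj (d - k) * (1 + ‖s‖) ^ D := by
      intro k hk
      refine (norm_eval_le (g (d - k)) s).trans ?_
      refine mul_le_mul_of_nonneg_left ?_ (hCj0 _)
      refine pow_le_pow_right₀ hP1 ?_
      exact Finset.le_sup (f := fun j => (g j).natDegree) (Finset.mem_range.2 (by omega))
    refine (Finset.sum_le_sum hterm).trans ?_
    rw [← Finset.sum_mul]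
    refine mul_le_mul_of_nonneg_right ?_ (pow_nonneg (by linarith) _)
    -- `Σ_{k<d'} C_{d-k} ≤ Σ_{j ≤ d} C_j` by the injective reindexing `k ↦ d - k`
    have hinj : Set.InjOn (fun k => d - k) (range d' : Finset ℕ) := by
      intro k hk k' hk' h
      have hk1 := Finset.mem_range.1 (Finset.mem_coe.1 hk)
      have hk2 := Finset.mem_range.1 (Finset.mem_coe.1 hk')
      simp only at h
      omega
    rw [← Finset.sum_image hinj]
    refine Finset.sum_le_sum_of_subset_of_nonneg ?_ fun j _ _ => hCj0 j
    intro j hj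
    rw [Finset.mem_image] at hj
    obtain ⟨k, hk, rfl⟩ := hj
    exact Finset.mem_range.2 (by omega)
  have hden : κ ≤ ‖(g t).eval s‖ := hlow s hR
  rw [had']
  calc (∑ k ∈ range d', ‖a k‖) / ‖(g t).eval s‖
      ≤ (K * (1 + ‖s‖) ^ D) / κ :=
        div_le_div₀ (mul_nonneg hK0 (pow_nonneg (by linarith) _)) hnum hκ hden
    _ = K / κ * (1 + ‖s‖) ^ D := by ring

/-! ## Registered stub (crux stmt-Schanuel-0969, line `kernel-arithmetic-selection`, gen 19 toolkit) -/

/-- **Registered stub `stub_normExpBoundsOfExpPolyZero` (PROVED)** — the exponential of a large zero `s` of a non-zero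
`m(e^s, s)`, `m ∈ ℚ[T, S]`, is polynomially bounded ABOVE AND BELOW: `max(‖e^s‖, ‖e^{-s}‖) ≤ max 1 (C (1+‖s‖)^D)` for
`‖s‖ ≥ R₀` (leading/trailing coefficient dominance, Pólya). -/
theorem stub_normExpBoundsOfExpPolyZero : ∀ (m : MvPolynomial (Fin 2) ℚ), m ≠ 0 → ∃ R₀ C : ℝ, ∃ D : ℕ, 0 ≤ C ∧ ∀ s : ℂ, MvPolynomial.aeval ![Complex.exp s, s] m = 0 → R₀ ≤ ‖s‖ → ‖Complex.exp s‖ ≤ max 1 (C * (1 + ‖s‖) ^ D) ∧ ‖Complex.exp (-s)‖ ≤ max 1 (C * (1 + ‖s‖) ^ D) := by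
  intro m hm
  obtain ⟨R₁, C₁, D₁, hC₁, h₁⟩ := norm_exp_le_of_expPoly_eq_zero hm
  obtain ⟨R₂, C₂, D₂, hC₂, h₂⟩ := norm_exp_neg_le_of_expPoly_eq_zero hm
  refine ⟨max R₁ R₂, max C₁ C₂, max D₁ D₂, le_max_of_le_left hC₁, fun s hs hR => ?_⟩
  have hP1 : 1 ≤ 1 + ‖s‖ := by linarith [norm_nonneg s]
  have hbig : ∀ (C : ℝ) (D : ℕ), 0 ≤ C → C ≤ max C₁ C₂ → D ≤ max D₁ D₂ →
      max 1 (C * (1 + ‖s‖) ^ D) ≤ max 1 (max C₁ C₂ * (1 + ‖s‖) ^ max D₁ D₂) := by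
    intro C D hC hCle hDle
    refine max_le_max le_rfl ?_
    exact mul_le_mul hCle (pow_le_pow_right₀ hP1 hDle) (pow_nonneg (by linarith) _)
      (hC.trans hCle)
  exact ⟨(h₁ s hs (le_trans (le_max_left _ _) hR)).trans (hbig C₁ D₁ hC₁ (le_max_left _ _) (le_max_left _ _)),
    (h₂ s hs (le_trans (le_max_right _ _) hR)).trans (hbig C₂ D₂ hC₂ (le_max_right _ _) (le_max_right _ _))⟩

end Summit.Schanuel.Schanuel.Cruxes.MinimalCounterexampleInAcl.KernelArithmeticSelection.MateGrowth

end
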